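import Summits.QuantumFields.BalabanUV.T4Continuum.Support.VariationalColourDirichletForm
import Summits.QuantumFields.BalabanUV.T4Continuum.Support.VariationalColourScalarPair
import Summits.QuantumFields.BalabanUV.T4Continuum.Support.VariationalCovariantRegularity

/-!
# T⁴ programme, spine node NE2 (U1a), lane P2 — SUPPLIER ITEM «V-COL-CLOSED», file B: LEAF REG⁺-COLOUR (Laplacian form) — the
# Euler–Lagrange structure of the constrained minimiser for E-valued 0-forms under UNITARY site operators (the multiplier, without KKT)
# and the bound `Σ_x ‖(D†D f)(x)‖² ≤ (Λ∕n^d)·Σ_μ dirUv R f μ` by UB⁺-duality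
# (the colour re-run of leaf-09-g3's `VariationalCovariantRegularity`; leaf REG⁺-colour, Euler–Lagrange half, part 2∕3)

NE2 formalisation swarm `b2b-balaban-t4-ne2-formalise-*`, leaf prover 02 (gen 5); register P2-sup, item «V-COL-CLOSED» (INTENT CLAIMS.log
l.14931).  Carriers BY NAME: `VariationalColourFederbush.{cDv, dirUv, Qcv}` (p214930), `VariationalColourBochner.{nsqv, Dirv, DirAdjv, negLapv,
ipv}` (p215065), file A `VariationalColourDirichletForm.{dformv, ipv_negLapv_left, ipv_negLapv_eq_zero_of_isMin}`; the block bijection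
`B5Blocks16.bpt_bijective`, leaf-09-g3's coordinate form `VariationalCovariantRegularity.bpt_eq_bpt_iff` and leaf-02-g4's
`VariationalColourScalarPair.apply_star_apply` BY NAME.
 * §1 BLOCK STRUCTURE (Euler–Lagrange WITHOUT KKT), UNITARY site operators `T`: the two-point test fields
   `δ_{bpt z j}(T(bpt z j)⋆ w) − δ_{bpt z j₀}(T(bpt z j₀)⋆ w)` lie in `ker Qcv T` (`Qcv_swapTestv`); testing file A's first variation against
   them shows `j ↦ T(bpt z j)((D†D f)(bpt z j))` is CONSTANT on every block (`apply_negLapv_eq_of_isMin`) — the multiplier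
   `multv T R f : Tor M → E` — and `(D†D f)(bpt z j) = T(bpt z j)⋆ (multv z)` (`negLapv_bpt_of_isMin`), hence
   `Σ_x ‖D†D f‖² = n^d·Σ_z ‖multv z‖²` (`nsqv_negLapv_eq_of_isMin`);
 * §2 MULTIPLIER BOUND BY UB⁺-DUALITY: the pairing identity `Σ_x ⟪(D†D f)(x), λ x⟫ = n^d·Σ_z‖multv z‖²` for ANY field `λ` with
   `Qcv T λ = multv` (`ipv_negLapv_of_isMin`), Cauchy–Schwarz `‖dformv g f‖² ≤ (Σ dirUv g)(Σ dirUv f)` (`norm_dformv_sq_le`), and a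
   competitor for the datum `multv` of the UB⁺ shape (`hUB : ∀ ν, ∃ λ, Qcv T λ = ν ∧ Σ_μ dirUv R λ μ ≤ Λ·Σ_z‖ν z‖²` — leaf-03-g4's
   `VariationalColourUpperBound.exists_ubv_phys` shape in lattice units, NOT discharged here) give `n^{2d}·Σ_z‖multv z‖² ≤ Λ·Σ_μ dirUv R f μ`
   (`nsqv_multv_le_of_isMin`) and the END

     `nsqv (negLapv R f) ≤ Λ∕n^d · Σ_μ dirUv R f μ`      (`nsqv_negLapv_le_of_isMin`)

   — leaf REG⁺-colour, Laplacian form; k-UNIFORM in physical units (file C); no NE3, no propagator; NO commutativity used anywhere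
   (unitarity enters only as `T⋆T = TT⋆ = 1` and `‖T⋆ v‖ = ‖v‖`).

HONEST FRAMING (T4-DAG p. 1).  Model level: bond operators `R` (DATA, no size assumption) and UNITARY site operators `T` (DATA) on the
level-`n` torus over the unit torus; lattice units; 0-form sector; ONE level.  Elementary, [folklore]; nothing printed is a hypothesis; no
`def … : Prop`; no `sorry`; axioms standard.  NE2 NOT proved; spine PROVED 0∕9; rung (B)+1 finite T⁴ — NOT infinite volume, NOT a mass gap,
NOT Clay.  HONEST DEPENDENCY (cell, verbatim): continuum YM on T⁴ ⇐ BetaPertH ∧ nine spine estimates (0/9 proved); BetaPertH ⇐ (D1) ∧ (D4) ∧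
CAP+tail; G-an2-4 gates asym, D1 and NE2/3/4.
-/

noncomputable section

namespace Summit.QuantumFields.BalabanUV.T4Continuum.VariationalColourRegularity

open Finset
open scoped InnerProductSpace ComplexConjugate
open Literature.MathematicalPhysics.QuantumFieldTheory.Balaban1983to89
open Literature.MathematicalPhysics.QuantumFieldTheory.Balaban1983to89.B5Prop11Plancherel (Tor fine unitVec)
open Literature.MathematicalPhysics.QuantumFieldTheory.Balaban1983to89.B5Block118 (bpt)
open Literature.MathematicalPhysics.QuantumFieldTheory.Balaban1983to89.B5Blocks16 (bpt_bijective)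
open Summit.QuantumFields.BalabanUV.T4Continuum.VariationalColourFederbush (cDv dirUv Qcv dirUv_nonneg)
open Summit.QuantumFields.BalabanUV.T4Continuum.VariationalColourBochner (nsqv Dirv DirAdjv negLapv ipv norm_ipv_le)
open Summit.QuantumFields.BalabanUV.T4Continuum.VariationalColourDirichletForm
  (dformv ipv_sub_left ipv_negLapv_left ipv_negLapv_eq_zero_of_isMin)
open Summit.QuantumFields.BalabanUV.T4Continuum.VariationalCovariantRegularity (bpt_eq_bpt_iff)
open Summit.QuantumFields.BalabanUV.T4Continuum.VariationalColourScalarPair (apply_star_apply)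

variable {d : ℕ} {E : Type*} [NormedAddCommGroup E] [InnerProductSpace ℂ E] [CompleteSpace E]
variable (n : ℕ) [NeZero n] (M : Fin d → ℕ) [hM : ∀ μ, NeZero (M μ)]

/-! ## §1 Block structure of the Euler–Lagrange equation for unitary site operators (the multiplier, without KKT) -/

omit [InnerProductSpace ℂ E] [CompleteSpace E] in
/-- sums over the fine torus, block by block (the tree's block bijection `B5Blocks16.bpt_bijective`, any additive target). [folklore] -/
theorem sum_blocks_v {β : Type*} [AddCommMonoid β] (F : Tor (fine n M) → β) :
    ∑ x, F x = ∑ z : Tor M, ∑ j : Fin d → Fin n, F (bpt n M z j) := by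
  rw [← (bpt_bijective n M).sum_comp F, Fintype.sum_prod_type]

omit [InnerProductSpace ℂ E] [CompleteSpace E] in
/-- a transported block sum against an `E`-valued point mass sitting at `bpt z j`. [folklore] -/
theorem sum_block_singlev [NormedSpace ℂ E] (T : Tor (fine n M) → (E →L[ℂ] E)) (z z' : Tor M) (j : Fin d → Fin n) (v : E) :
    ∑ j', T (bpt n M z' j') ((Pi.single (bpt n M z j) v : Tor (fine n M) → E) (bpt n M z' j'))
      = if z' = z then T (bpt n M z j) v else 0 := by
  simp_rw [Pi.single_apply, bpt_eq_bpt_iff n M]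
  by_cases hz : z' = z
  · subst hz
    rw [if_pos rfl, Finset.sum_eq_single j]
    · simp
    · intro j' _ hj'; simp [hj']
    · intro h; exact absurd (Finset.mem_univ j) h
  · rw [if_neg hz]
    exact Finset.sum_eq_zero fun j' _ => by simp [hz]

omit [CompleteSpace E] in
/-- the pairing of an `E`-valued point mass with a field: `Σ_x ⟪δ_p(v) x, L x⟫ = ⟪v, L p⟫`. [folklore] -/
theorem ipv_single (p : Tor (fine n M)) (v : E) (L : Tor (fine n M) → E) :
    ipv (fine n M) (Pi.single p v : Tor (fine n M) → E) L = ⟪v, L p⟫_ℂ := by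
  unfold ipv
  rw [Finset.sum_eq_single p]
  · simp
  · intro x _ hx; simp [hx]
  · intro h; exact absurd (Finset.mem_univ _) h

/-- the TWO-POINT TEST FIELD inside block `z` for site operators `T` and a vector `w`:
`δ_{bpt z j}(T(bpt z j)⋆ w) − δ_{bpt z j₀}(T(bpt z j₀)⋆ w)`. [folklore] -/
def swapTestv (T : Tor (fine n M) → (E →L[ℂ] E)) (z : Tor M) (j j₀ : Fin d → Fin n) (w : E) : Tor (fine n M) → E :=
  (Pi.single (bpt n M z j) (star (T (bpt n M z j)) w) : Tor (fine n M) → E) - Pi.single (bpt n M z j₀) (star (T (bpt n M z j₀)) w)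

/-- unitary site operators: `T⋆ (T v) = v`. [folklore] -/
theorem star_apply_apply {U : E →L[ℂ] E} (hU : U ∈ unitary (E →L[ℂ] E)) (v : E) : star U (U v) = v := by
  rw [← mul_apply_eq_comp, Unitary.star_mul_self_of_mem hU, one_apply_eq_self]

/-- `⟪T⋆ w, u⟫ = ⟪w, T u⟫`. [folklore] -/
theorem inner_star_apply_left (U : E →L[ℂ] E) (w u : E) : ⟪star U w, u⟫_ℂ = ⟪w, U u⟫_ℂ := by
  rw [ContinuousLinearMap.star_eq_adjoint]; exact ContinuousLinearMap.adjoint_inner_left U u w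

/-- `Qcv T (two-point test) = 0` for UNITARY site operators. [folklore] -/
theorem Qcv_swapTestv {T : Tor (fine n M) → (E →L[ℂ] E)} (hT : ∀ x, T x ∈ unitary (E →L[ℂ] E)) (z : Tor M)
    (j j₀ : Fin d → Fin n) (w : E) : Qcv n M T (swapTestv n M T z j j₀ w) = 0 := by
  funext z'
  simp only [Qcv, swapTestv, Pi.sub_apply, map_sub, Finset.sum_sub_distrib, sum_block_singlev, Pi.zero_apply]
  by_cases hz : z' = z
  · simp [hz, apply_star_apply (hT _)]
  · simp [hz]

/-- pairing the two-point test field with a field `L`: `⟪w, T(bpt z j)(L(bpt z j))⟫ − ⟪w, T(bpt z j₀)(L(bpt z j₀))⟫`. [folklore] -/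
theorem ipv_swapTestv (T : Tor (fine n M) → (E →L[ℂ] E)) (z : Tor M) (j j₀ : Fin d → Fin n) (w : E) (L : Tor (fine n M) → E) :
    ipv (fine n M) (swapTestv n M T z j j₀ w) L
      = ⟪w, T (bpt n M z j) (L (bpt n M z j))⟫_ℂ - ⟪w, T (bpt n M z j₀) (L (bpt n M z j₀))⟫_ℂ := by
  unfold swapTestv
  rw [ipv_sub_left, ipv_single, ipv_single, inner_star_apply_left, inner_star_apply_left]

/-- **EULER–LAGRANGE, BLOCK FORM**: at a constrained minimiser, `j ↦ T(bpt z j)((D†D f)(bpt z j))` is CONSTANT on every block. [folklore] -/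
theorem apply_negLapv_eq_of_isMin {T : Tor (fine n M) → (E →L[ℂ] E)} (hT : ∀ x, T x ∈ unitary (E →L[ℂ] E))
    (R : Tor (fine n M) → Fin d → (E →L[ℂ] E)) {μ : Tor M → E} {f : Tor (fine n M) → E} (hf : Qcv n M T f = μ)
    (hmin : ∀ g, Qcv n M T g = μ → ∑ ν, dirUv (fine n M) R f ν ≤ ∑ ν, dirUv (fine n M) R g ν) (z : Tor M) (j j₀ : Fin d → Fin n) :
    T (bpt n M z j) (negLapv (fine n M) R f (bpt n M z j)) = T (bpt n M z j₀) (negLapv (fine n M) R f (bpt n M z j₀)) := by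
  refine ext_inner_left ℂ fun w => ?_
  have h0 := ipv_negLapv_eq_zero_of_isMin n M T R hf hmin (Qcv_swapTestv n M hT z j j₀ w)
  rw [ipv_swapTestv] at h0
  exact sub_eq_zero.mp h0

/-- the EULER–LAGRANGE MULTIPLIER `c(z) = T(bpt z 0)((D†D f)(bpt z 0)) ∈ E` (read on the block's base corner). [folklore] -/
def multv (T : Tor (fine n M) → (E →L[ℂ] E)) (R : Tor (fine n M) → Fin d → (E →L[ℂ] E)) (f : Tor (fine n M) → E) (z : Tor M) : E :=
  T (bpt n M z 0) (negLapv (fine n M) R f (bpt n M z 0))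

/-- **EULER–LAGRANGE**: at a constrained minimiser `(D†D f)(bpt z j) = T(bpt z j)⋆ (c z)`, i.e. `D†D f = (Qcv T)⋆(n^d c)` — from the first
variation alone. [folklore] -/
theorem negLapv_bpt_of_isMin {T : Tor (fine n M) → (E →L[ℂ] E)} (hT : ∀ x, T x ∈ unitary (E →L[ℂ] E))
    (R : Tor (fine n M) → Fin d → (E →L[ℂ] E)) {μ : Tor M → E} {f : Tor (fine n M) → E} (hf : Qcv n M T f = μ)
    (hmin : ∀ g, Qcv n M T g = μ → ∑ ν, dirUv (fine n M) R f ν ≤ ∑ ν, dirUv (fine n M) R g ν) (z : Tor M) (j : Fin d → Fin n) :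
    negLapv (fine n M) R f (bpt n M z j) = star (T (bpt n M z j)) (multv n M T R f z) := by
  have h := apply_negLapv_eq_of_isMin n M hT R hf hmin z j 0
  unfold multv
  rw [← h, star_apply_apply (hT _)]

/-- hence `Σ_x ‖(D†D f)(x)‖² = n^d·Σ_z ‖c z‖²` (`‖T⋆ v‖ = ‖v‖`). [folklore] -/
theorem nsqv_negLapv_eq_of_isMin {T : Tor (fine n M) → (E →L[ℂ] E)} (hT : ∀ x, T x ∈ unitary (E →L[ℂ] E))
    (R : Tor (fine n M) → Fin d → (E →L[ℂ] E)) {μ : Tor M → E} {f : Tor (fine n M) → E} (hf : Qcv n M T f = μ)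
    (hmin : ∀ g, Qcv n M T g = μ → ∑ ν, dirUv (fine n M) R f ν ≤ ∑ ν, dirUv (fine n M) R g ν) :
    nsqv (fine n M) (negLapv (fine n M) R f) = (n : ℝ) ^ d * ∑ z, ‖multv n M T R f z‖ ^ 2 := by
  unfold nsqv
  rw [sum_blocks_v n M (fun x => ‖negLapv (fine n M) R f x‖ ^ 2), Finset.mul_sum]
  refine sum_congr rfl fun z _ => ?_
  simp_rw [negLapv_bpt_of_isMin n M hT R hf hmin z,
    ContinuousLinearMap.norm_map_of_mem_unitary (Unitary.star_mem (hT _))]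
  rw [sum_const, nsmul_eq_mul, Finset.card_univ, Fintype.card_fun, Fintype.card_fin, Fintype.card_fin]
  push_cast
  ring

/-! ## §2 The multiplier bound by UB⁺-duality and the END (leaf REG⁺-colour, Laplacian form) -/

omit hM [CompleteSpace E] in
/-- block sums recover the average: `Σ_j T(bpt z j)(λ(bpt z j)) = n^d • (Qcv T λ)(z)`. [folklore] -/
theorem sum_block_apply_eq (T : Tor (fine n M) → (E →L[ℂ] E)) (lam : Tor (fine n M) → E) (z : Tor M) :
    ∑ j, T (bpt n M z j) (lam (bpt n M z j)) = ((n : ℂ) ^ d) • Qcv n M T lam z := by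
  have hn : ((n : ℂ) ^ d) ≠ 0 := pow_ne_zero _ (by exact_mod_cast NeZero.ne n)
  simp only [Qcv, smul_smul, mul_inv_cancel₀ hn, one_smul]

/-- the Euler–Lagrange identity tested against any field `λ` with `Qcv T λ = c`: `Σ_x ⟪(D†D f)(x), λ x⟫ = n^d·Σ_z‖c z‖²`. [folklore] -/
theorem ipv_negLapv_of_isMin {T : Tor (fine n M) → (E →L[ℂ] E)} (hT : ∀ x, T x ∈ unitary (E →L[ℂ] E))
    (R : Tor (fine n M) → Fin d → (E →L[ℂ] E)) {μ : Tor M → E} {f : Tor (fine n M) → E} (hf : Qcv n M T f = μ)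
    (hmin : ∀ g, Qcv n M T g = μ → ∑ ν, dirUv (fine n M) R f ν ≤ ∑ ν, dirUv (fine n M) R g ν)
    {lam : Tor (fine n M) → E} (hlam : Qcv n M T lam = multv n M T R f) :
    ipv (fine n M) (negLapv (fine n M) R f) lam = (((n : ℝ) ^ d * ∑ z, ‖multv n M T R f z‖ ^ 2 : ℝ) : ℂ) := by
  unfold ipv
  rw [sum_blocks_v n M (fun x => ⟪negLapv (fine n M) R f x, lam x⟫_ℂ)]
  push_cast
  rw [Finset.mul_sum]
  refine sum_congr rfl fun z _ => ?_
  simp_rw [negLapv_bpt_of_isMin n M hT R hf hmin z, inner_star_apply_left]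
  rw [← inner_sum, sum_block_apply_eq, hlam, inner_smul_right]
  congr 1
  exact inner_self_eq_norm_sq_to_K (𝕜 := ℂ) _

omit [CompleteSpace E] in
/-- Cauchy–Schwarz for the sesquilinear colour Dirichlet form: `‖dformv g f‖² ≤ (Σ_μ dirUv g)(Σ_μ dirUv f)`. [folklore] -/
theorem norm_dformv_sq_le {N : Fin d → ℕ} [∀ μ, NeZero (N μ)] (R : Tor N → Fin d → (E →L[ℂ] E)) (g f : Tor N → E) :
    ‖dformv N R g f‖ ^ 2 ≤ (∑ μ, dirUv N R g μ) * ∑ μ, dirUv N R f μ := by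
  set F : Fin d × Tor N → ℝ := fun p => ‖cDv N R g p.2 p.1‖ with hF
  set G : Fin d × Tor N → ℝ := fun p => ‖cDv N R f p.2 p.1‖ with hG
  have h1 : ‖dformv N R g f‖ ≤ ∑ p : Fin d × Tor N, F p * G p := by
    rw [Fintype.sum_prod_type]
    unfold dformv
    refine (norm_sum_le _ _).trans (sum_le_sum fun μ _ => (norm_ipv_le N _ _).trans (le_of_eq rfl))
  have h2 := Finset.sum_mul_sq_le_sq_mul_sq (Finset.univ) F G
  have hg : ∑ p : Fin d × Tor N, F p ^ 2 = ∑ μ, dirUv N R g μ := by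
    rw [Fintype.sum_prod_type]; rfl
  have hf : ∑ p : Fin d × Tor N, G p ^ 2 = ∑ μ, dirUv N R f μ := by
    rw [Fintype.sum_prod_type]; rfl
  rw [hg, hf] at h2
  exact (pow_le_pow_left₀ (norm_nonneg _) h1 2).trans h2

/-- **THE MULTIPLIER BOUND** (skeleton REG⁺: «n^{−d}‖ν‖² ≤ Λ·n⁻²·Δ′_k(μ)», colour): at a constrained minimiser, for any UB⁺-type constant `Λ`,
`n^{2d}·Σ_z‖c z‖² ≤ Λ·Σ_μ dirUv R f μ`. [folklore] -/
theorem nsqv_multv_le_of_isMin {T : Tor (fine n M) → (E →L[ℂ] E)} (hT : ∀ x, T x ∈ unitary (E →L[ℂ] E))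
    (R : Tor (fine n M) → Fin d → (E →L[ℂ] E)) {Λ : ℝ} (hΛ : 0 ≤ Λ)
    (hUB : ∀ ν : Tor M → E, ∃ lam : Tor (fine n M) → E, Qcv n M T lam = ν ∧ ∑ μ, dirUv (fine n M) R lam μ ≤ Λ * ∑ z, ‖ν z‖ ^ 2)
    {μ : Tor M → E} {f : Tor (fine n M) → E} (hf : Qcv n M T f = μ)
    (hmin : ∀ g, Qcv n M T g = μ → ∑ ν, dirUv (fine n M) R f ν ≤ ∑ ν, dirUv (fine n M) R g ν) :
    ((n : ℝ) ^ d) ^ 2 * ∑ z, ‖multv n M T R f z‖ ^ 2 ≤ Λ * ∑ ν, dirUv (fine n M) R f ν := by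
  set m : ℝ := ∑ z, ‖multv n M T R f z‖ ^ 2 with hm
  have hm0 : 0 ≤ m := sum_nonneg fun _ _ => sq_nonneg _
  have hdir0 : 0 ≤ ∑ ν, dirUv (fine n M) R f ν := sum_nonneg fun ν _ => dirUv_nonneg _ _ _ _
  obtain ⟨lam, hlam, hlamb⟩ := hUB (multv n M T R f)
  -- the pairing identity and Cauchy–Schwarz
  have key : (((n : ℝ) ^ d * m : ℝ) : ℂ) = dformv (fine n M) R f lam := by
    rw [← ipv_negLapv_left, ipv_negLapv_of_isMin n M hT R hf hmin hlam]
  have hnorm : (n : ℝ) ^ d * m = ‖dformv (fine n M) R f lam‖ := by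
    rw [← key, Complex.norm_real, Real.norm_of_nonneg (by positivity)]
  have hsq : ((n : ℝ) ^ d * m) ^ 2 ≤ Λ * m * ∑ ν, dirUv (fine n M) R f ν := by
    calc ((n : ℝ) ^ d * m) ^ 2 = ‖dformv (fine n M) R f lam‖ ^ 2 := by rw [hnorm]
      _ ≤ (∑ ν, dirUv (fine n M) R f ν) * ∑ ν, dirUv (fine n M) R lam ν := norm_dformv_sq_le R f lam
      _ ≤ (∑ ν, dirUv (fine n M) R f ν) * (Λ * m) := mul_le_mul_of_nonneg_left hlamb hdir0
      _ = Λ * m * ∑ ν, dirUv (fine n M) R f ν := by ring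
  rcases eq_or_lt_of_le hm0 with h0 | hpos
  · rw [← h0, mul_zero]; positivity
  · have : ((n : ℝ) ^ d) ^ 2 * m * m ≤ Λ * (∑ ν, dirUv (fine n M) R f ν) * m := by nlinarith
    exact le_of_mul_le_mul_right this hpos

/-- **LEAF REG⁺-COLOUR (Laplacian form), END**: at a constrained minimiser of the colour Dirichlet sum on the fibre `{Qcv T g = μ}`
(UNITARY site operators `T`, bond operators `R` arbitrary),

  `Σ_x ‖(D†D f)(x)‖² ≤ (Λ∕n^d)·Σ_μ dirUv R f μ`

for every UB⁺-type constant `Λ` (`hUB`, the `hUBc` shape of leaf-03-g4's `exists_ubv_phys` in lattice units).  In physical units with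
`Λ = Λ_phys·n^{d−2}`: `‖D†D H_kμ‖²_{L²} ≤ Λ_phys·Δ′_k(μ)` — k-UNIFORM, no NE3, no propagator. [folklore] -/
theorem nsqv_negLapv_le_of_isMin {T : Tor (fine n M) → (E →L[ℂ] E)} (hT : ∀ x, T x ∈ unitary (E →L[ℂ] E))
    (R : Tor (fine n M) → Fin d → (E →L[ℂ] E)) {Λ : ℝ} (hΛ : 0 ≤ Λ)
    (hUB : ∀ ν : Tor M → E, ∃ lam : Tor (fine n M) → E, Qcv n M T lam = ν ∧ ∑ μ, dirUv (fine n M) R lam μ ≤ Λ * ∑ z, ‖ν z‖ ^ 2)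
    {μ : Tor M → E} {f : Tor (fine n M) → E} (hf : Qcv n M T f = μ)
    (hmin : ∀ g, Qcv n M T g = μ → ∑ ν, dirUv (fine n M) R f ν ≤ ∑ ν, dirUv (fine n M) R g ν) :
    nsqv (fine n M) (negLapv (fine n M) R f) ≤ Λ / (n : ℝ) ^ d * ∑ ν, dirUv (fine n M) R f ν := by
  have hn : (0 : ℝ) < (n : ℝ) ^ d := by have := NeZero.ne n; positivity
  rw [nsqv_negLapv_eq_of_isMin n M hT R hf hmin]
  have h := nsqv_multv_le_of_isMin n M hT R hΛ hUB hf hmin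
  rw [div_mul_eq_mul_div, le_div_iff₀ hn]
  calc (n : ℝ) ^ d * (∑ z, ‖multv n M T R f z‖ ^ 2) * (n : ℝ) ^ d = ((n : ℝ) ^ d) ^ 2 * ∑ z, ‖multv n M T R f z‖ ^ 2 := by ring
    _ ≤ Λ * ∑ ν, dirUv (fine n M) R f ν := h

end Summit.QuantumFields.BalabanUV.T4Continuum.VariationalColourRegularity

end
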